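import Mathlib
import Literature.Analysis.FluidPDE.IsometryInvariance
import Summits.NavierStokesRegularity.NavierStokesRegularity.Theorems.PlaneEnergyCeilingPlanarEnergyAPrioriSlabLawMild
import Summits.NavierStokesRegularity.NavierStokesRegularity.Theorems.PlaneEnergyCeilingPlanarEnergyAPrioriFluxLedgerDir

/-!
# Route PlaneEnergyCeiling · crux `PlanarEnergyAPriori` — the mild slab law WITH THE SINK (parts)

Helper file for the crux item stmt-NavierStokesRegularity-16855 (`PlanarEnergyAPriori`, route
`PlaneEnergyCeiling`), landed `--supports` that item, toward its single open piece
`stub_fluxConvergenceBudget`. The landed mild slab law `stub_slabLawMild` DROPS the dissipation;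
every attack on the budget has to pay the flux convergence with exactly that sink (crux informal
statement: "control −∂_cF at the maximising plane against ν∂²_cE and the sink 2νD"). This file
keeps it — the CALORIC DISSIPATION through the plane `{x₂ = c₀}`,

  `S(t;c₀) = 2ν ∫₀ᵗ ∫ G_{ν(t−s)}(x₂ − c₀) Σⱼ‖∂ⱼu(s,x)‖² dx ds`,

and proves, along a classical solution on `[0,t]` with order-(3,2) decay,

  `E(t;c₀) + S(t;c₀) ≤ sup_{c'} E(0;c') + 2∫₀ᵗ (√(πν(t−s)))⁻¹ · osc_{a,b}‖F(s,a) − F(s,b)‖ₑ ds`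

in `ℝ≥0∞` (assembled in `Theorems/…SlabLawSink.lean`). THIS FILE HOLDS THE PARTS: the slice IDENTITY
`∫(W'|u|² + W·2⟪acc,u⟫) = −2ν∫GΣ‖∂ⱼu‖² + 2∫G'(c−c₀)F(c)dc` (`slabLaw_sliceIdentity`; the landed
inequality `slabLaw_sliceBound` was its signed-away form), the flux term against `G'` in `ℝ≥0∞`
(`ofReal_two_mul_integral_kernelDeriv_mul_sub_le`), the continuity of the caloric dissipation in
time (`continuousOn_caloricDissipation`: joint smoothness of the slice derivatives, dominated
convergence) and the time-integrability of the slice-density integral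
(`integrableOn_sliceDensityIntegral`: Tonelli). Folklore (CKN 1982 §2 with a caloric weight).
-/

noncomputable section

-- single-conjunct summit: `Summit.<Summit>.<Problem>` repeats the name by the D-0017 layout
set_option linter.dupNamespace false

namespace Summit.NavierStokesRegularity.NavierStokesRegularity.Theorems.PlanarEnergyAPriori

open MeasureTheory Set Filter Topology Function WithLp Real
open scoped ENNReal RealInnerProductSpace Laplacian
open Literature.Analysis.FluidPDE Literature.Analysis.UnboundedOperators
open Summit.NavierStokesRegularity.NavierStokesRegularity.Theorems.PlaneEnergyCeilingSlabEnergyIdentity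
open Summit.NavierStokesRegularity.NavierStokesRegularity.Theorems.PlanarEnergyAPriori.SlabLaw

/-! ### The slice identity -/

section Slice

variable {ν σ : ℝ} {u : EuclideanSpace ℝ (Fin 3) → EuclideanSpace ℝ (Fin 3)} {p : EuclideanSpace ℝ (Fin 3) → ℝ} {C : ℝ}

/-- **THE SLICE IDENTITY.** For a `C²` divergence-free `u` and a `C¹` scalar `p` with order-(3,2)
decay, a continuous tendency field `acc = νΔu − (u·∇)u − ∇p` (`ν ≥ 0`), `σ > 0`, `c₀ ∈ ℝ`: with the
caloric weight `W = G_σ(x₂ − c₀)`, `W' = −νG_σ''(x₂ − c₀)` and the planar Bernoulli flux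
`F(c) = ∫_{x₂=c}(|u|²/2 + p)u₂`,
`∫ (W'|u|² + W·2⟪acc,u⟫) = −2ν ∫ G_σ(x₂−c₀) Σⱼ‖∂ⱼu‖² + 2∫ G_σ'(c − c₀) F(c) dc`. [folklore] -/
theorem slabLaw_sliceIdentity (hν : 0 ≤ ν) (hσ : 0 < σ) (c₀ : ℝ)
    (hu : ContDiff ℝ 2 u) (hp : ContDiff ℝ 1 p) (hdiv : VectorCalculus.IsDivFree u)
    (h0 : ∀ x, ‖u x‖ ≤ C * (1 + ‖x‖) ^ (-(3 : ℝ))) (h1 : ∀ x, ‖fderiv ℝ u x‖ ≤ C * (1 + ‖x‖) ^ (-(3 : ℝ)))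
    (h2 : ∀ x, ‖iteratedFDeriv ℝ 2 u x‖ ≤ C * (1 + ‖x‖) ^ (-(3 : ℝ)))
    (k0 : ∀ x, ‖p x‖ ≤ C * (1 + ‖x‖) ^ (-(2 : ℝ))) (k1 : ∀ x, ‖fderiv ℝ p x‖ ≤ C * (1 + ‖x‖) ^ (-(2 : ℝ)))
    (hacc : Continuous fun x => ν • Δ u x - convect u u x - gradient p x) :
    ∫ x, (-ν * (((x 2 - c₀) ^ 2 / (4 * σ ^ 2) - 1 / (2 * σ)) * heatKernel σ (x 2 - c₀)) * ‖u x‖ ^ 2 +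
        heatKernel σ (x 2 - c₀) * (2 * ⟪ν • Δ u x - convect u u x - gradient p x, u x⟫)) =
      -(2 * ν * ∫ x, heatKernel σ (x 2 - c₀) * ∑ j : Fin 3, ‖fderiv ℝ u x (EuclideanSpace.single j 1)‖ ^ 2) +
        2 * ∫ c : ℝ, (-((c - c₀) / (2 * σ)) * heatKernel σ (c - c₀)) *
          ∫ y : EuclideanSpace ℝ (Fin 2), (‖u (toLp 2 ![y 0, y 1, c])‖ ^ 2 / 2 + p (toLp 2 ![y 0, y 1, c])) *
            u (toLp 2 ![y 0, y 1, c]) 2 := by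
  have hC : 0 ≤ C := nonneg_of_norm_le_rpow h0
  obtain ⟨K, hB0, hB1, hB2⟩ := heatKernel_shift_bounds hσ c₀
  have hg : ContDiff ℝ 2 (fun z => heatKernel σ (z - c₀)) := contDiff_heatKernel_shift σ c₀
  have hg'K : ∀ z, |deriv (fun z => heatKernel σ (z - c₀)) z| ≤ K := by
    rw [deriv_heatKernel_shift]; exact hB1
  have hg''K : ∀ z, |deriv (deriv fun z => heatKernel σ (z - c₀)) z| ≤ K := by
    rw [deriv2_heatKernel_shift]; exact hB2
  -- the weighted energy identity with the caloric weight
  have hWI := weightedEnergyIdentity_of_decay ν hu hp hdiv h0 h1 h2 k0 k1 hg hB0 hg'K hg''K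
  rw [deriv2_heatKernel_shift, deriv_heatKernel_shift] at hWI
  beta_reduce at hWI
  -- continuity of the explicit weights
  have hcG : Continuous fun z : ℝ => heatKernel σ (z - c₀) := (contDiff_heatKernel_shift σ c₀ (n := 0)).continuous
  have hcG' : Continuous fun z : ℝ => -((z - c₀) / (2 * σ)) * heatKernel σ (z - c₀) := by fun_prop
  have hcG'' : Continuous fun z : ℝ => ((z - c₀) ^ 2 / (4 * σ ^ 2) - 1 / (2 * σ)) * heatKernel σ (z - c₀) := by
    fun_prop
  -- integrability of the two parts of the density
  have hIsq : Integrable fun x => ‖u x‖ ^ 2 := integrable_norm_sq hu.continuous h0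
  have hIX : Integrable fun x : EuclideanSpace ℝ (Fin 3) =>
      (((x 2 - c₀) ^ 2 / (4 * σ ^ 2) - 1 / (2 * σ)) * heatKernel σ (x 2 - c₀)) * ‖u x‖ ^ 2 :=
    integrable_weight_mul hIsq hcG'' hB2
  have hIW' : Integrable fun x : EuclideanSpace ℝ (Fin 3) =>
      (-ν * (((x 2 - c₀) ^ 2 / (4 * σ ^ 2) - 1 / (2 * σ)) * heatKernel σ (x 2 - c₀))) * ‖u x‖ ^ 2 := by
    have := hIX.const_mul (-ν)
    refine this.congr (ae_of_all _ fun x => ?_)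
    dsimp only
    ring
  have k1' : ∀ x, ‖gradient p x‖ ≤ C * (1 + ‖x‖) ^ (-(2 : ℝ)) := fun x => by
    rw [← norm_fderiv_eq_norm_gradient]; exact k1 x
  have hr : (Module.finrank ℝ (EuclideanSpace ℝ (Fin 3)) : ℝ) < 5 := by
    rw [finrank_euclideanSpace, Fintype.card_fin]; norm_num
  have hIacc : Integrable fun x : EuclideanSpace ℝ (Fin 3) =>
      heatKernel σ (x 2 - c₀) * (2 * ⟪ν • Δ u x - convect u u x - gradient p x, u x⟫) := by
    refine Integrable.mono' ((integrable_one_add_norm hr).const_mul (2 * K * C * (3 * ν * C + C ^ 2 + C)))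
      ((continuous_weight hcG).mul (continuous_const.mul (hacc.inner hu.continuous))).aestronglyMeasurable
      (ae_of_all _ fun x => ?_)
    exact norm_weight_mul_two_inner_acc_le hν hC (h0 x) (h1 x) (h2 x) (k1' x) hB0
  -- split and cancel
  rw [integral_add hIW' hIacc]
  have hW' : ∫ x : EuclideanSpace ℝ (Fin 3),
      (-ν * (((x 2 - c₀) ^ 2 / (4 * σ ^ 2) - 1 / (2 * σ)) * heatKernel σ (x 2 - c₀))) * ‖u x‖ ^ 2 =
      -ν * ∫ x : EuclideanSpace ℝ (Fin 3),
        (((x 2 - c₀) ^ 2 / (4 * σ ^ 2) - 1 / (2 * σ)) * heatKernel σ (x 2 - c₀)) * ‖u x‖ ^ 2 := by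
    rw [← integral_const_mul]
    refine integral_congr_ae (ae_of_all _ fun x => ?_)
    dsimp only; ring
  have hcomm : ∫ x : EuclideanSpace ℝ (Fin 3),
      heatKernel σ (x 2 - c₀) * (2 * ⟪ν • Δ u x - convect u u x - gradient p x, u x⟫) =
      ∫ x : EuclideanSpace ℝ (Fin 3),
        heatKernel σ (x 2 - c₀) * (2 * ⟪u x, ν • Δ u x - convect u u x - gradient p x⟫) :=
    integral_congr_ae (ae_of_all _ fun x => by dsimp only; rw [real_inner_comm])
  have hf : Integrable fun x => (‖u x‖ ^ 2 / 2 + p x) * u x 2 := integrable_bernoulli_mul' (hu.of_le one_le_two) hp h0 k0 2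
  rw [hW', hcomm, hWI, integral_weight_mul_eq_integral_mul_integral_plane hf hcG' hB1]
  ring

end Slice

/-! ### The flux term against the kernel derivative, in `ℝ≥0∞` -/

/-- For `σ > 0`, any `F : ℝ → ℝ` and any `c₁`:
`ofReal (2∫ G_σ'(c − c₀)(F(c) − F(c₁)) dc) ≤ 2 · ofReal((√(πσ))⁻¹) · sup_{a,b} ‖F(a) − F(b)‖ₑ`
(the sharp `L¹` norm of `G_σ'`). -/
theorem ofReal_two_mul_integral_kernelDeriv_mul_sub_le {σ : ℝ} (hσ : 0 < σ) (c₀ c₁ : ℝ) (F : ℝ → ℝ) :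
    ENNReal.ofReal (2 * ∫ c : ℝ, (-((c - c₀) / (2 * σ)) * heatKernel σ (c - c₀)) * (F c - F c₁)) ≤
      2 * (ENNReal.ofReal ((Real.sqrt (π * σ))⁻¹) * ⨆ (a : ℝ) (b : ℝ), ‖F a - F b‖ₑ) := by
  obtain ⟨S, hS⟩ : ∃ S : ℝ≥0∞, S = ⨆ (a : ℝ) (b : ℝ), ‖F a - F b‖ₑ := ⟨_, rfl⟩
  rw [← hS]
  have hmeas : Measurable fun c : ℝ => ‖-((c - c₀) / (2 * σ)) * heatKernel σ (c - c₀)‖ₑ := by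
    have hw : Continuous fun z : ℝ => -((z - c₀) / (2 * σ)) * heatKernel σ (z - c₀) := by
      have hcG : Continuous fun z : ℝ => heatKernel σ (z - c₀) := (contDiff_heatKernel_shift σ c₀ (n := 0)).continuous
      fun_prop
    exact hw.measurable.enorm
  have hker : ∫⁻ c : ℝ, ‖-((c - c₀) / (2 * σ)) * heatKernel σ (c - c₀)‖ₑ = ENNReal.ofReal ((Real.sqrt (π * σ))⁻¹) := by
    rw [lintegral_sub_right_eq_self (fun z : ℝ => ‖-(z / (2 * σ)) * heatKernel σ z‖ₑ) c₀]
    exact lintegral_enorm_deriv_heatKernel_real hσ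
  calc ENNReal.ofReal (2 * ∫ c : ℝ, (-((c - c₀) / (2 * σ)) * heatKernel σ (c - c₀)) * (F c - F c₁))
      ≤ 2 * ‖∫ c : ℝ, (-((c - c₀) / (2 * σ)) * heatKernel σ (c - c₀)) * (F c - F c₁)‖ₑ := by
        rw [ENNReal.ofReal_mul zero_le_two, ENNReal.ofReal_ofNat]
        gcongr
        rw [Real.enorm_eq_ofReal_abs]
        exact ENNReal.ofReal_le_ofReal (le_abs_self _)
    _ ≤ 2 * ∫⁻ c : ℝ, ‖(-((c - c₀) / (2 * σ)) * heatKernel σ (c - c₀)) * (F c - F c₁)‖ₑ := by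
        gcongr; exact enorm_integral_le_lintegral_enorm _
    _ ≤ 2 * ∫⁻ c : ℝ, ‖-((c - c₀) / (2 * σ)) * heatKernel σ (c - c₀)‖ₑ * S := by
        gcongr with c
        rw [enorm_mul]
        gcongr
        rw [hS]
        exact le_iSup₂ (f := fun a b => ‖F a - F b‖ₑ) c c₁
    _ = 2 * (ENNReal.ofReal ((Real.sqrt (π * σ))⁻¹) * S) := by
        rw [lintegral_mul_const _ hmeas, hker]

/-! ### Along a classical solution: the caloric dissipation and the slice-density integral -/

section Along

variable {ν t : ℝ} {u : ℝ → EuclideanSpace ℝ (Fin 3) → EuclideanSpace ℝ (Fin 3)} {p : ℝ → EuclideanSpace ℝ (Fin 3) → ℝ} {C : ℝ}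

/-- **The caloric dissipation is continuous in time** on every `[0,s₁]`, `s₁ < t`:
`s ↦ ∫ G_{ν(t−s)}(x₂ − c₀) Σⱼ‖∂ⱼu(s,x)‖² dx` (joint continuity of the slice derivatives of a
jointly smooth field, `(1+‖x‖)⁻⁶` domination). [folklore] -/
theorem continuousOn_caloricDissipation (hν : 0 < ν) (ht : 0 < t) (hsm : IsSmoothSpaceTimeOn (Icc 0 t) u)
    (h1 : ∀ s ∈ Icc 0 t, ∀ x, ‖fderiv ℝ (u s) x‖ ≤ C * (1 + ‖x‖) ^ (-(3 : ℝ))) (c₀ : ℝ) {s₁ : ℝ} (hs₁t : s₁ < t) :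
    ContinuousOn (fun s => ∫ x, heatKernel (ν * (t - s)) (x 2 - c₀) *
      ∑ j : Fin 3, ‖fderiv ℝ (u s) x (EuclideanSpace.single j 1)‖ ^ 2) (Icc 0 s₁) := by
  have hU : UniqueDiffOn ℝ (Icc 0 t) := uniqueDiffOn_Icc ht
  have hσpos : ∀ s, s ≤ s₁ → 0 < ν * (t - s) := fun s hs => mul_pos hν (by linarith)
  set K0 : ℝ := (4 * π * (ν * (t - s₁))) ^ (-(1 : ℝ) / 2) with hK0
  have hK0nn : 0 ≤ K0 := by positivity
  have hWb : ∀ s, s ≤ s₁ → ∀ z, |heatKernel (ν * (t - s)) (z - c₀)| ≤ K0 := fun s hs z => by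
    rw [abs_of_nonneg (heatKernel_pos (hσpos s hs) _).le]
    exact (heatKernel_real_le (hσpos s hs) _).trans (rpow_neg_half_antitone (hσpos s₁ le_rfl) (by nlinarith))
  have hsum : ∀ s ∈ Icc 0 t, ∀ x, ∑ j : Fin 3, ‖fderiv ℝ (u s) x (EuclideanSpace.single j 1)‖ ^ 2 ≤
      3 * (C ^ 2 * (1 + ‖x‖) ^ (-(6 : ℝ))) := by
    intro s hs x
    calc ∑ j : Fin 3, ‖fderiv ℝ (u s) x (EuclideanSpace.single j 1)‖ ^ 2
        ≤ ∑ _j : Fin 3, C ^ 2 * (1 + ‖x‖) ^ (-(6 : ℝ)) := Finset.sum_le_sum fun j _ => norm_sq_fderiv_le_weight (h1 s hs x) j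
      _ = 3 * (C ^ 2 * (1 + ‖x‖) ^ (-(6 : ℝ))) := by simp [Finset.sum_const]
  have hr6 : (Module.finrank ℝ (EuclideanSpace ℝ (Fin 3)) : ℝ) < 6 := by
    rw [finrank_euclideanSpace, Fintype.card_fin]; norm_num
  refine continuousOn_of_dominated (bound := fun x => K0 * (3 * (C ^ 2 * (1 + ‖x‖) ^ (-(6 : ℝ)))))
    (fun s hs => ?_) (fun s hs => ae_of_all _ fun x => ?_) ?_ (ae_of_all _ fun x => ?_)
  · -- continuity in `x`
    have hsT : s ∈ Icc 0 t := ⟨hs.1, hs.2.trans hs₁t.le⟩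
    have hc1 : Continuous fun x => fderiv ℝ (u s) x := (hsm.contDiff_slice hsT).continuous_fderiv (by simp)
    have hcG : Continuous fun z : ℝ => heatKernel (ν * (t - s)) (z - c₀) :=
      (contDiff_heatKernel_shift (ν * (t - s)) c₀ (n := 0)).continuous
    exact ((continuous_weight hcG).mul
      (continuous_finsetSum _ fun j _ => ((hc1.clm_apply continuous_const).norm.pow 2))).aestronglyMeasurable
  · -- domination
    have hsT : s ∈ Icc 0 t := ⟨hs.1, hs.2.trans hs₁t.le⟩
    have hnn : 0 ≤ ∑ j : Fin 3, ‖fderiv ℝ (u s) x (EuclideanSpace.single j 1)‖ ^ 2 :=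
      Finset.sum_nonneg fun j _ => sq_nonneg _
    rw [norm_mul, Real.norm_eq_abs, Real.norm_of_nonneg hnn]
    exact mul_le_mul (hWb s hs.2 (x 2)) (hsum s hsT x) hnn hK0nn
  · exact (((integrable_one_add_norm hr6).const_mul (C ^ 2)).const_mul 3).const_mul K0
  · -- continuity in `s` for every `x`
    have hker : ContinuousOn (fun s => heatKernel (ν * (t - s)) (x 2 - c₀)) (Icc 0 s₁) := fun s hs =>
      (hasDerivAt_heatKernel_backward (hσpos s hs.2) (x 2 - c₀)).continuousAt.continuousWithinAt
    have hD : ∀ j : Fin 3, ContinuousOn (fun s => fderiv ℝ (u s) x (EuclideanSpace.single j 1)) (Icc 0 t) := fun j =>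
      (hsm.fderiv_slice_apply hU (EuclideanSpace.single j 1)).continuousOn.comp
        (continuous_id.prodMk continuous_const).continuousOn fun s hs => ⟨hs, mem_univ _⟩
    have hS : ContinuousOn (fun s => ∑ j : Fin 3, ‖fderiv ℝ (u s) x (EuclideanSpace.single j 1)‖ ^ 2) (Icc 0 s₁) :=
      (continuousOn_finsetSum _ fun j _ => ((hD j).norm.pow 2)).mono (Icc_subset_Icc_right hs₁t.le)
    exact hker.mul hS

/-- **The slice-density integral is integrable in time** on `(0,s₁)`, `0 < s₁ < t`: with
`W(τ,x) = G_{ν(t−τ)}(x₂ − c₀)`, `W' = ∂_τW`, the function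
`τ ↦ ∫ (W'|u|² + W·2⟪νΔu − (u·∇)u − ∇p, u⟫) dx` is integrable (Tonelli on `(0,s₁) × ℝ³`: the density
is jointly continuous on `[0,s₁] × ℝ³` and dominated by `A(1+‖x‖)⁻⁵`). [folklore] -/
theorem integrableOn_sliceDensityIntegral (hν : 0 < ν) (ht : 0 < t) (hcl : IsClassicalNSSolutionOn (Icc 0 t) ν 0 u p)
    (h0 : ∀ s ∈ Icc 0 t, ∀ x, ‖u s x‖ ≤ C * (1 + ‖x‖) ^ (-(3 : ℝ)))
    (h1 : ∀ s ∈ Icc 0 t, ∀ x, ‖fderiv ℝ (u s) x‖ ≤ C * (1 + ‖x‖) ^ (-(3 : ℝ)))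
    (h2 : ∀ s ∈ Icc 0 t, ∀ x, ‖iteratedFDeriv ℝ 2 (u s) x‖ ≤ C * (1 + ‖x‖) ^ (-(3 : ℝ)))
    (k1 : ∀ s ∈ Icc 0 t, ∀ x, ‖gradient (p s) x‖ ≤ C * (1 + ‖x‖) ^ (-(2 : ℝ)))
    (c₀ : ℝ) {s₁ : ℝ} (hs₁ : 0 < s₁) (hs₁t : s₁ < t) :
    IntegrableOn (fun τ => ∫ x, (-ν * (((x 2 - c₀) ^ 2 / (4 * (ν * (t - τ)) ^ 2) - 1 / (2 * (ν * (t - τ)))) *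
        heatKernel (ν * (t - τ)) (x 2 - c₀)) * ‖u τ x‖ ^ 2 +
        heatKernel (ν * (t - τ)) (x 2 - c₀) *
          (2 * ⟪ν • Δ (u τ) x - convect (u τ) (u τ) x - gradient (p τ) x, u τ x⟫))) (Ioo 0 s₁) := by
  have hC : 0 ≤ C := nonneg_of_norm_le_rpow (h0 0 ⟨le_rfl, ht.le⟩)
  have hU₁ : UniqueDiffOn ℝ (Icc 0 s₁) := uniqueDiffOn_Icc hs₁
  have hsub : Icc 0 s₁ ⊆ Icc 0 t := Icc_subset_Icc_right hs₁t.le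
  have hcl₁ : IsClassicalNSSolutionOn (Icc 0 s₁) ν 0 u p := hcl.mono hsub hU₁
  -- the weight and its time derivative
  set W : ℝ → EuclideanSpace ℝ (Fin 3) → ℝ := fun τ x => heatKernel (ν * (t - τ)) (x 2 - c₀) with hW
  set W' : ℝ → EuclideanSpace ℝ (Fin 3) → ℝ := fun τ x =>
    -ν * (((x 2 - c₀) ^ 2 / (4 * (ν * (t - τ)) ^ 2) - 1 / (2 * (ν * (t - τ)))) *
      heatKernel (ν * (t - τ)) (x 2 - c₀)) with hW'
  have hσpos : ∀ τ, τ ≤ s₁ → 0 < ν * (t - τ) := fun τ hτ => mul_pos hν (by linarith)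
  -- joint continuity on `[0,s₁] × ℝ³`
  have hmaps : MapsTo (fun q : ℝ × EuclideanSpace ℝ (Fin 3) => (ν * (t - q.1), q.2 2 - c₀))
      (Icc 0 s₁ ×ˢ univ) (Ioi (0 : ℝ) ×ˢ (univ : Set ℝ)) := fun q hq =>
    ⟨hσpos q.1 hq.1.2, mem_univ _⟩
  have hin : Continuous fun q : ℝ × EuclideanSpace ℝ (Fin 3) => (ν * (t - q.1), q.2 2 - c₀) := by fun_prop
  have hWc : ContinuousOn (uncurry W) (Icc 0 s₁ ×ˢ univ) :=
    (continuousOn_uncurry_heatKernel' (E := ℝ)).comp hin.continuousOn hmaps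
  have hWsc : ContinuousOn (uncurry W') (Icc 0 s₁ ×ˢ univ) := by
    have hpoly : ContinuousOn (fun q : ℝ × EuclideanSpace ℝ (Fin 3) =>
        (q.2 2 - c₀) ^ 2 / (4 * (ν * (t - q.1)) ^ 2) - 1 / (2 * (ν * (t - q.1)))) (Icc 0 s₁ ×ˢ univ) := by
      refine ContinuousOn.sub (ContinuousOn.div (by fun_prop) (by fun_prop) fun q hq => ?_)
        (ContinuousOn.div continuousOn_const (by fun_prop) fun q hq => ?_)
      · have := hσpos q.1 hq.1.2; positivity
      · have := hσpos q.1 hq.1.2; positivity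
    have : uncurry W' = fun q : ℝ × EuclideanSpace ℝ (Fin 3) =>
        -ν * (((q.2 2 - c₀) ^ 2 / (4 * (ν * (t - q.1)) ^ 2) - 1 / (2 * (ν * (t - q.1)))) * uncurry W q) := by
      funext q; rfl
    rw [this]
    exact continuousOn_const.mul (hpoly.mul hWc)
  -- uniform bounds on `[0,s₁]`
  set K0 : ℝ := (4 * π * (ν * (t - s₁))) ^ (-(1 : ℝ) / 2) with hK0
  have hK0nn : 0 ≤ K0 := by positivity
  have hWb : ∀ τ, τ ≤ s₁ → ∀ z, |heatKernel (ν * (t - τ)) (z - c₀)| ≤ K0 := fun τ hτ z => by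
    rw [abs_of_nonneg (heatKernel_pos (hσpos τ hτ) _).le]
    exact (heatKernel_real_le (hσpos τ hτ) _).trans (rpow_neg_half_antitone (hσpos s₁ le_rfl) (by nlinarith))
  have hW'b : ∀ τ, τ ≤ s₁ → ∀ z,
      |-ν * (((z - c₀) ^ 2 / (4 * (ν * (t - τ)) ^ 2) - 1 / (2 * (ν * (t - τ)))) * heatKernel (ν * (t - τ)) (z - c₀))| ≤
        ν * (K0 * (3 / (2 * (ν * (t - s₁))))) := fun τ hτ z => by
    have hσ := hσpos τ hτ
    rw [abs_mul, abs_neg, abs_of_pos hν]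
    refine mul_le_mul_of_nonneg_left ((abs_deriv2_heatKernel_real_le hσ (z - c₀)).trans ?_) hν.le
    refine mul_le_mul (rpow_neg_half_antitone (hσpos s₁ le_rfl) (by nlinarith)) ?_ (by positivity) hK0nn
    exact div_le_div_of_nonneg_left (by norm_num) (by have := hσpos s₁ le_rfl; positivity) (by nlinarith)
  -- the `(1+‖x‖)⁻⁵` majorant of the density
  set A : ℝ := ν * (K0 * (3 / (2 * (ν * (t - s₁))))) * C ^ 2 + 2 * K0 * C * (3 * ν * C + C ^ 2 + C) with hA
  have hA0 : 0 ≤ A := by have := hσpos s₁ le_rfl; positivity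
  have hr : (Module.finrank ℝ (EuclideanSpace ℝ (Fin 3)) : ℝ) < 5 := by
    rw [finrank_euclideanSpace, Fintype.card_fin]; norm_num
  have hBint : Integrable fun x : EuclideanSpace ℝ (Fin 3) => A * (1 + ‖x‖) ^ (-(5 : ℝ)) :=
    (integrable_one_add_norm hr).const_mul A
  have hBnn : ∀ x : EuclideanSpace ℝ (Fin 3), 0 ≤ A * (1 + ‖x‖) ^ (-(5 : ℝ)) := fun x =>
    mul_nonneg hA0 (rpow_neg_pos x 5).le
  have hdom : ∀ τ ∈ Icc 0 s₁, ∀ x,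
      ‖W' τ x * ‖u τ x‖ ^ 2 + W τ x * (2 * ⟪timeDerivWithin (Icc 0 s₁) u τ x, u τ x⟫)‖ ≤
        A * (1 + ‖x‖) ^ (-(5 : ℝ)) := by
    intro τ hτ x
    have hτ' : τ ∈ Icc 0 t := hsub hτ
    rw [timeDerivWithin_eq_acc hcl₁ hτ x, hA, add_mul]
    refine (norm_add_le _ _).trans (add_le_add ?_ ?_)
    · rw [norm_mul, Real.norm_eq_abs, Real.norm_of_nonneg (sq_nonneg _)]
      have h65 : (1 + ‖x‖) ^ (-(6 : ℝ)) ≤ (1 + ‖x‖) ^ (-(5 : ℝ)) := rpow_neg_le_rpow_neg_of_le x (by norm_num)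
      calc |W' τ x| * ‖u τ x‖ ^ 2 ≤ ν * (K0 * (3 / (2 * (ν * (t - s₁))))) * (C ^ 2 * (1 + ‖x‖) ^ (-(6 : ℝ))) :=
            mul_le_mul (hW'b τ hτ.2 (x 2)) (norm_sq_le_weight (h0 τ hτ' x)) (sq_nonneg _)
              (by have := hσpos s₁ le_rfl; positivity)
        _ ≤ ν * (K0 * (3 / (2 * (ν * (t - s₁))))) * (C ^ 2 * (1 + ‖x‖) ^ (-(5 : ℝ))) := by
            have := hσpos s₁ le_rfl; gcongr
        _ = _ := by ring
    · exact norm_weight_mul_two_inner_acc_le hν.le hC (h0 τ hτ' x) (h1 τ hτ' x) (h2 τ hτ' x) (k1 τ hτ' x)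
        (hWb τ hτ.2)
  have hfin : ∫⁻ τ in Ioo 0 s₁, ∫⁻ x, ‖W' τ x * ‖u τ x‖ ^ 2 +
      W τ x * (2 * ⟪timeDerivWithin (Icc 0 s₁) u τ x, u τ x⟫)‖ₑ < ∞ := by
    have hslice : ∀ τ ∈ Ioo 0 s₁, ∫⁻ x, ‖W' τ x * ‖u τ x‖ ^ 2 +
        W τ x * (2 * ⟪timeDerivWithin (Icc 0 s₁) u τ x, u τ x⟫)‖ₑ ≤
          ENNReal.ofReal (∫ x : EuclideanSpace ℝ (Fin 3), A * (1 + ‖x‖) ^ (-(5 : ℝ))) := by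
      intro τ hτ
      rw [ofReal_integral_eq_lintegral_ofReal hBint (ae_of_all _ hBnn)]
      refine lintegral_mono fun x => ?_
      rw [← ofReal_norm]
      exact ENNReal.ofReal_le_ofReal (hdom τ ⟨hτ.1.le, hτ.2.le⟩ x)
    calc _ ≤ ∫⁻ _ in Ioo 0 s₁, ENNReal.ofReal (∫ x : EuclideanSpace ℝ (Fin 3), A * (1 + ‖x‖) ^ (-(5 : ℝ))) :=
          setLIntegral_mono' measurableSet_Ioo hslice
      _ < ∞ := by
          rw [setLIntegral_const, Real.volume_Ioo]
          exact ENNReal.mul_lt_top ENNReal.ofReal_lt_top ENNReal.ofReal_lt_top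
  -- Tonelli: the density is integrable on `(0,s₁) × ℝ³`, hence so is its `x`-integral in `τ`
  have hu_cont : ContinuousOn (uncurry u) (Icc 0 s₁ ×ˢ univ) := hcl₁.smooth_velocity.continuousOn
  have hdt_cont : ContinuousOn (uncurry (timeDerivWithin (Icc 0 s₁) u)) (Icc 0 s₁ ×ˢ univ) :=
    (hcl₁.smooth_velocity.timeDerivWithin hU₁).continuousOn
  set D : ℝ × EuclideanSpace ℝ (Fin 3) → ℝ := fun z => W' z.1 z.2 * ‖u z.1 z.2‖ ^ 2 +
    W z.1 z.2 * (2 * ⟪timeDerivWithin (Icc 0 s₁) u z.1 z.2, u z.1 z.2⟫) with hD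
  have hDcont : ContinuousOn D (Icc 0 s₁ ×ˢ univ) :=
    (hWsc.mul (hu_cont.norm.pow 2)).add (hWc.mul (continuousOn_const.mul (hdt_cont.inner hu_cont)))
  have hDint := integrable_prod_of_continuousOn_of_lintegral hDcont (by simpa [hD] using hfin)
  have hI := hDint.integral_prod_left
  simp only [hD] at hI
  refine hI.congr ((ae_restrict_iff' measurableSet_Ioo).2 (ae_of_all _ fun τ hτ => ?_))
  have hτ' : τ ∈ Icc 0 s₁ := ⟨hτ.1.le, hτ.2.le⟩
  simp_rw [timeDerivWithin_eq_acc hcl₁ hτ']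
  rfl

end Along

/-- **The slice identity, registered closed form** (sub-goal `slabLaw_sliceIdentity_closedForm`
of stmt-NavierStokesRegularity-16855). [folklore] -/
theorem slabLaw_sliceIdentity_closedForm : ∀ (ν σ c₀ : ℝ), 0 ≤ ν → 0 < σ → ∀ (u : EuclideanSpace ℝ (Fin 3) → EuclideanSpace ℝ (Fin 3)) (p : EuclideanSpace ℝ (Fin 3) → ℝ) (C : ℝ), ContDiff ℝ 2 u → ContDiff ℝ 1 p → Literature.Analysis.FluidPDE.VectorCalculus.IsDivFree u → (∀ x, ‖u x‖ ≤ C * (1 + ‖x‖) ^ (-(3 : ℝ))) → (∀ x, ‖fderiv ℝ u x‖ ≤ C * (1 + ‖x‖) ^ (-(3 : ℝ))) → (∀ x, ‖iteratedFDeriv ℝ 2 u x‖ ≤ C * (1 + ‖x‖) ^ (-(3 : ℝ))) → (∀ x, ‖p x‖ ≤ C * (1 + ‖x‖) ^ (-(2 : ℝ))) → (∀ x, ‖fderiv ℝ p x‖ ≤ C * (1 + ‖x‖) ^ (-(2 : ℝ))) → (Continuous fun x => ν • Laplacian.laplacian u x - Literature.Analysis.FluidPDE.convect u u x - gradient p x)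 → ∫ x, (-ν * (((x 2 - c₀) ^ 2 / (4 * σ ^ 2) - 1 / (2 * σ)) * Literature.Analysis.UnboundedOperators.heatKernel σ (x 2 - c₀)) * ‖u x‖ ^ 2 + Literature.Analysis.UnboundedOperators.heatKernel σ (x 2 - c₀) * (2 * inner ℝ (ν • Laplacian.laplacian u x - Literature.Analysis.FluidPDE.convect u u x - gradient p x) (u x))) = -(2 * ν * ∫ x, Literature.Analysis.UnboundedOperators.heatKernel σ (x 2 - c₀) * ∑ j : Fin 3, ‖fderiv ℝ u x (EuclideanSpace.single j 1)‖ ^ 2) + 2 * ∫ c : ℝ, (-((c - c₀) / (2 * σ)) * Literature.Analysis.UnboundedOperators.heatKernel σ (c - c₀)) * ∫ y : EuclideanSpace ℝ (Fin 2), (‖u (WithLp.toLp 2 ![y 0, y 1, c])‖ ^ 2 / 2 + p (WithLp.toLp 2 ![y 0, y 1, c])) * u (WithLp.toLp 2 ![y 0, y 1, c]) 2 :=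
  fun _ _ c₀ hν hσ _ _ _ hu hp hdiv h0 h1 h2 k0 k1 hacc =>
    slabLaw_sliceIdentity hν hσ c₀ hu hp hdiv h0 h1 h2 k0 k1 hacc

end Summit.NavierStokesRegularity.NavierStokesRegularity.Theorems.PlanarEnergyAPriori

end
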